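import Mathlib
import Summits.ResolutionOfSingularities.ResolutionOfSingularities.Theorems.HomologicalConductorPersistenceSurfaceStepAddCover
import HarnessLib

/-!
# Rung S-2 `PersistenceSurface` (stmt-ResolutionOfSingularities-19970) — w44b-o10c:
# the BLOCK-AGNOSTIC step (a generator stably annihilated by `caⁿ⁺¹` of the étale-local base)
# and the reflexive-dual trick (hull blocks of SECOND syzygies whose duals are `n`-th syzygies)

Route `ResolutionOfSingularities/HomologicalConductor`, chain W4.4b (cell res-hironaka; seat res-D-pv-043, named
reserve for o10). OURS; nothing here is a statement of the manuscript under review (Hironaka 2017); AI-written,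
weaker than expert review.

o8's interface `HasStepDualCover` (p507867) and o10a/o10b (p512214, draft) fix the SHAPE of the cover blocks:
single duals `(T'' ⊗_{T₁} Y j)*` of `n`-th-syzygy `T₁`-modules `Y j`. res-L1-w44b-tri-1's VACUITY (b) §C memo
(2026-08-27T08:06:07Z) observes that with this shape the cover clause at a rational step is the condition (DC_p)
on DUAL specials, not the printed specials-to-specials statement (E-sur), whose natural blocks are reflexive
HULLS `(T'' ⊗ M i)**` of the specials `M i` — and specials are only SECOND syzygies, which `x ∈ ca⁴` does not
stably annihilate through CA1 directly. This file records the two kernel facts that dissolve the rigidity: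

* `algebraMap_mem_cohomologyAnnihilatorOfDegree_succ_of_stepGenerator` — the step theorem with NO block shape:
  over the square `T → T₁ → T''`, `T → T' → T''` (ascent to `T₁`, descent from `T''`) it suffices to have ONE
  finitely generated `T''`-module `G` with (a) `G` stably annihilated by the image of every element of `caⁿ⁺¹(T₁)`
  and (b) every `n`-th syzygy over `T''` in `add G`. Every block calculus (base change HC-3, duals HC-0, hulls,
  products FC-2, retracts HC-R) is then the DISCHARGER's business via the tree's `StablyAnnihilates` API;
* `stablyAnnihilates_of_mem_of_isReflexive_of_dual_isSyzygy` — THE REFLEXIVE-DUAL TRICK: if `x ∈ caⁿ⁺¹(T)`, `L` is a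
  reflexive `T`-module and its dual `L*` is an `n`-th syzygy of a finitely generated module, then `x` stably
  annihilates `L` (CA1 on `L*`, then CA3 `stablyAnnihilates_iff_dual`). Over a rational surface singularity the
  specials are reflexive and their duals are third syzygies (Iyama–Wemyss: the duality `(-)* : SCM R → Ω CM R` onto the first syzygies of CM modules, arXiv:0905.3940 §2), so
  `x ∈ ca⁴` DOES stably annihilate the specials — level four can consume (E-sur) in its printed, hull form;
* `stablyAnnihilates_hullGenerator` / `algebraMap_mem_cohomologyAnnihilatorOfDegree_succ_of_stepHullCoverOfReflexive`
  — the hull-block instance: `M i` reflexive `T₁`-modules with `(M i)*` `n`-th syzygies, generator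
  `G := T'' ⊕ ⊕ᵢ (T'' ⊗_{T₁} M i)**`, cover clause «`n`-th syzygies over `T''` lie in `add G`» ⊢ the step;
* `stablyAnnihilates_dualGenerator` / `…_of_stepDualGenerator` — the dual-block instance (o8/o10a's shape) for
  comparison, and `…_of_stepMixedGenerator` — hull blocks of reflexive `M i` AND dual blocks of syzygies `Y j`
  together (generator `T'' ⊕ ⊕ᵢ (T'' ⊗ M i)** ⊕ ⊕ⱼ (T'' ⊗ Y j)*`).

References: S. B. Iyengar, R. Takahashi, *Annihilation of cohomology and strong generation of module
categories*, IMRN 2016, arXiv:1404.1476 [`IyengarTakahashi2014`].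
-/

set_option linter.dupNamespace false

noncomputable section

open CategoryTheory Literature.RingTheory.CohomologyAnnihilator
open Summit.ResolutionOfSingularities.ResolutionOfSingularities.Theorems.NoZeno.SandwichCluster
open Summit.ResolutionOfSingularities.ResolutionOfSingularities.Theorems.HomologicalConductor.PersistenceSurfaceHullCover
open Summit.ResolutionOfSingularities.ResolutionOfSingularities.Theorems.HomologicalConductor.PersistenceSurfaceFiniteCover
open scoped TensorProduct

namespace Summit.ResolutionOfSingularities.ResolutionOfSingularities.Theorems.HomologicalConductor.PersistenceSurfaceStepGenerator

universe u

/-! ## The block-agnostic step -/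

/-- **`add G` inherits stable annihilation.** If `x` stably annihilates `G` then it stably annihilates every
`L ∈ add G` (powers FC-2, retracts HC-R). [cite: IyengarTakahashi2014, Remark 2.13] -/
theorem stablyAnnihilates_of_isRetractOfPower {R : Type u} [CommRing R] {x : R} {G L : ModuleCat.{u} R}
    (hG : StablyAnnihilates R x G) (hL : IsRetractOfPower G L) : StablyAnnihilates R x L := by
  obtain ⟨m, i, p, hip⟩ := hL
  exact StablyAnnihilates.of_retract (StablyAnnihilates.pow (M := G) hG m) i p hip

/-- **The block-agnostic step (OURS · w44b-o10c).** `T → T'` a ring map, `T → T₁` a noetherian auxiliary algebra with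
level-`(n+1)` ascent, `T''` a noetherian common `T₁`- and `T'`-algebra (square on `T`) with level-`(n+1)` descent to
`T'`, and ONE `T''`-module `G` such that (a) the image of every element of `caⁿ⁺¹(T₁)` stably annihilates `G` and
(b) every `n`-th syzygy of a finitely generated `T''`-module lies in `add G`. Then `algebraMap T T' x ∈ caⁿ⁺¹(T')`
for all `x ∈ caⁿ⁺¹(T)`: ascent, (a), `add`-closure, CA1 backward over `T''`, descent.
[cite: IyengarTakahashi2014, Remark 2.13] -/
theorem algebraMap_mem_cohomologyAnnihilatorOfDegree_succ_of_stepGenerator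
    {T T' T₁ T'' : Type u} [CommRing T] [CommRing T'] [CommRing T₁] [CommRing T'']
    [Algebra T T'] [Algebra T T₁] [Algebra T₁ T''] [Algebra T' T''] [IsNoetherianRing T''] (n : ℕ) {x : T}
    (hx : x ∈ cohomologyAnnihilatorOfDegree T (n + 1))
    (hasc : (cohomologyAnnihilatorOfDegree T (n + 1)).map (algebraMap T T₁) ≤
      cohomologyAnnihilatorOfDegree T₁ (n + 1))
    (hsq : ∀ t : T, algebraMap T₁ T'' (algebraMap T T₁ t) = algebraMap T' T'' (algebraMap T T' t))
    (hdesc : (cohomologyAnnihilatorOfDegree T'' (n + 1)).comap (algebraMap T' T'') ≤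
      cohomologyAnnihilatorOfDegree T' (n + 1))
    (G : ModuleCat.{u} T'')
    (hG : ∀ y : T₁, y ∈ cohomologyAnnihilatorOfDegree T₁ (n + 1) →
      StablyAnnihilates T'' (algebraMap T₁ T'' y) G)
    (hIW : ∀ (M L : ModuleCat.{u} T''), Module.Finite T'' M → IsSyzygy n M L → IsRetractOfPower G L) :
    algebraMap T T' x ∈ cohomologyAnnihilatorOfDegree T' (n + 1) := by
  have h1 : algebraMap T T₁ x ∈ cohomologyAnnihilatorOfDegree T₁ (n + 1) := hasc (Ideal.mem_map_of_mem _ hx)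
  have h2 : StablyAnnihilates T'' (algebraMap T' T'' (algebraMap T T' x)) G := by
    rw [← hsq]
    exact hG _ h1
  have h3 : algebraMap T' T'' (algebraMap T T' x) ∈ cohomologyAnnihilatorOfDegree T'' (n + 1) :=
    (mem_cohomologyAnnihilatorOfDegree_succ_iff_forall_isSyzygy _).mpr fun M L hM hL =>
      stablyAnnihilates_of_isRetractOfPower h2 (hIW M L hM hL)
  exact hdesc (Ideal.mem_comap.mpr h3)

/-! ## The reflexive-dual trick -/

/-- **The reflexive-dual trick (OURS · w44b-o10c).** Over a noetherian ring `T`: if `x ∈ caⁿ⁺¹(T)`, `L` is a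
REFLEXIVE `T`-module and its dual `L* = Hom_T(L, T)` is an `n`-th syzygy of some finitely generated module, then
`x` stably annihilates `L` — CA1 (`mem_cohomologyAnnihilatorOfDegree_succ_iff_forall_isSyzygy`) gives it for `L*`,
and stable annihilation of a reflexive module is equivalent to that of its dual (CA3, `stablyAnnihilates_iff_dual`).
Use: over a rational surface singularity the special CM modules are reflexive with third-syzygy duals
(Iyama–Wemyss, arXiv:0905.3940 §2: `(-)*` is a duality `SCM R → Ω CM R`, and CM modules over a normal surface are second syzygies), so `ca⁴` stably annihilates the SPECIALS themselves, not only their duals.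
[cite: IyengarTakahashi2014, Remark 2.13] -/
theorem stablyAnnihilates_of_mem_of_isReflexive_of_dual_isSyzygy {T : Type u} [CommRing T] [IsNoetherianRing T]
    {n : ℕ} {x : T} (hx : x ∈ cohomologyAnnihilatorOfDegree T (n + 1)) (L : ModuleCat.{u} T)
    (hL : Module.IsReflexive T L)
    (hdual : ∃ M : ModuleCat.{u} T, Module.Finite T M ∧ IsSyzygy n M (ModuleCat.of T (Module.Dual T L))) :
    StablyAnnihilates T x L := by
  obtain ⟨M, hM, hsyz⟩ := hdual
  exact (stablyAnnihilates_iff_dual x L hL).mpr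
    ((mem_cohomologyAnnihilatorOfDegree_succ_iff_forall_isSyzygy x).mp hx M _ hM hsyz)

/-! ## Generators of the three block shapes -/

/-- **Hull generator.** `M i` reflexive `T₁`-modules whose duals are `n`-th syzygies; then the image of every
`y ∈ caⁿ⁺¹(T₁)` stably annihilates `T'' ⊕ ⊕ᵢ (T'' ⊗_{T₁} M i)**` (reflexive-dual trick, then HC-3 base change and
HC-0 twice = `StablyAnnihilates.dual_dual_baseChange`, FC-1/FC-2). [cite: IyengarTakahashi2014, Remark 2.13] -/
theorem stablyAnnihilates_hullGenerator {T₁ T'' : Type u} [CommRing T₁] [CommRing T''] [Algebra T₁ T'']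
    [IsNoetherianRing T₁] (n : ℕ) {κ : Type} [Fintype κ] (M : κ → ModuleCat.{u} T₁)
    (hM : ∀ i, Module.IsReflexive T₁ (M i) ∧
      ∃ X : ModuleCat.{u} T₁, Module.Finite T₁ X ∧ IsSyzygy n X (ModuleCat.of T₁ (Module.Dual T₁ (M i))))
    {y : T₁} (hy : y ∈ cohomologyAnnihilatorOfDegree T₁ (n + 1)) :
    StablyAnnihilates T'' (algebraMap T₁ T'' y)
      (ModuleCat.of T'' (T'' × (Π i, Module.Dual T'' (Module.Dual T'' (T'' ⊗[T₁] M i))))) :=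
  StablyAnnihilates.prod (StablyAnnihilates.of_free _ T'')
    (StablyAnnihilates.pi (fun i => Module.Dual T'' (Module.Dual T'' (T'' ⊗[T₁] M i))) fun i =>
      StablyAnnihilates.dual_dual_baseChange
        (stablyAnnihilates_of_mem_of_isReflexive_of_dual_isSyzygy hy (M i) (hM i).1 (hM i).2))

/-- **Dual generator** (o8/o10a's shape). `Y j` `n`-th-syzygy `T₁`-modules; the image of every `y ∈ caⁿ⁺¹(T₁)` stably
annihilates `T'' ⊕ ⊕ⱼ (T'' ⊗_{T₁} Y j)*` (CA1, HC-3, HC-0, FC-1/FC-2). [cite: IyengarTakahashi2014, Remark 2.13] -/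
theorem stablyAnnihilates_dualGenerator {T₁ T'' : Type u} [CommRing T₁] [CommRing T''] [Algebra T₁ T'']
    [IsNoetherianRing T₁] (n : ℕ) {ι : Type} [Fintype ι] (Y : ι → ModuleCat.{u} T₁)
    (hY : ∀ j, ∃ X : ModuleCat.{u} T₁, Module.Finite T₁ X ∧ IsSyzygy n X (Y j))
    {y : T₁} (hy : y ∈ cohomologyAnnihilatorOfDegree T₁ (n + 1)) :
    StablyAnnihilates T'' (algebraMap T₁ T'' y)
      (ModuleCat.of T'' (T'' × (Π j, Module.Dual T'' (T'' ⊗[T₁] Y j)))) :=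
  StablyAnnihilates.prod (StablyAnnihilates.of_free _ T'')
    (StablyAnnihilates.pi (fun j => Module.Dual T'' (T'' ⊗[T₁] Y j)) fun j => by
      obtain ⟨X, hX, hsyz⟩ := hY j
      exact StablyAnnihilates.dual_baseChange
        ((mem_cohomologyAnnihilatorOfDegree_succ_iff_forall_isSyzygy y).mp hy X (Y j) hX hsyz))

/-- **Mixed generator.** Hull blocks of reflexive `M i` (duals `n`-th syzygies) together with dual blocks of
`n`-th syzygies `Y j`: `T'' ⊕ ⊕ᵢ (T'' ⊗ M i)** ⊕ ⊕ⱼ (T'' ⊗ Y j)*` is stably annihilated by the image of `caⁿ⁺¹(T₁)`.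
[cite: IyengarTakahashi2014, Remark 2.13] -/
theorem stablyAnnihilates_mixedGenerator {T₁ T'' : Type u} [CommRing T₁] [CommRing T''] [Algebra T₁ T'']
    [IsNoetherianRing T₁] (n : ℕ) {κ ι : Type} [Fintype κ] [Fintype ι] (M : κ → ModuleCat.{u} T₁)
    (hM : ∀ i, Module.IsReflexive T₁ (M i) ∧
      ∃ X : ModuleCat.{u} T₁, Module.Finite T₁ X ∧ IsSyzygy n X (ModuleCat.of T₁ (Module.Dual T₁ (M i))))
    (Y : ι → ModuleCat.{u} T₁) (hY : ∀ j, ∃ X : ModuleCat.{u} T₁, Module.Finite T₁ X ∧ IsSyzygy n X (Y j))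
    {y : T₁} (hy : y ∈ cohomologyAnnihilatorOfDegree T₁ (n + 1)) :
    StablyAnnihilates T'' (algebraMap T₁ T'' y)
      (ModuleCat.of T'' ((T'' × (Π i, Module.Dual T'' (Module.Dual T'' (T'' ⊗[T₁] M i)))) ×
        (Π j, Module.Dual T'' (T'' ⊗[T₁] Y j)))) :=
  StablyAnnihilates.prod (stablyAnnihilates_hullGenerator n M hM hy)
    (StablyAnnihilates.pi (fun j => Module.Dual T'' (T'' ⊗[T₁] Y j)) fun j => by
      obtain ⟨X, hX, hsyz⟩ := hY j
      exact StablyAnnihilates.dual_baseChange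
        ((mem_cohomologyAnnihilatorOfDegree_succ_iff_forall_isSyzygy y).mp hy X (Y j) hX hsyz))

/-! ## The step with hull blocks of reflexive modules (the printed (E-sur) shape) -/

/-- **The step from a HULL cover by reflexive modules with syzygy duals (OURS · w44b-o10c).** Same frame as o8's
abstract step; module data: finitely many REFLEXIVE `T₁`-modules `M i` whose duals are `n`-th syzygies of finitely
generated modules (at a rational surface stage and `n = 3`: the special CM modules), and the cover clause «every
`n`-th syzygy of a finitely generated `T''`-module lies in `add (T'' ⊕ ⊕ᵢ (T'' ⊗_{T₁} M i)**)`» — the HULL shape in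
which the printed (E-sur) («the specials upstairs are direct summands of the reflexive hulls of the pulled-back
specials, and free») combines with (IW); how the clause is discharged is the model file's business, this theorem
only consumes it. Then `algebraMap T T' x ∈ caⁿ⁺¹(T')` for `x ∈ caⁿ⁺¹(T)`.
[cite: IyengarTakahashi2014, Remark 2.13] -/
theorem algebraMap_mem_cohomologyAnnihilatorOfDegree_succ_of_stepHullCoverOfReflexive
    {T T' T₁ T'' : Type u} [CommRing T] [CommRing T'] [CommRing T₁] [CommRing T'']
    [Algebra T T'] [Algebra T T₁] [Algebra T₁ T''] [Algebra T' T''] [IsNoetherianRing T₁] [IsNoetherianRing T'']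
    (n : ℕ) {x : T} (hx : x ∈ cohomologyAnnihilatorOfDegree T (n + 1))
    (hasc : (cohomologyAnnihilatorOfDegree T (n + 1)).map (algebraMap T T₁) ≤
      cohomologyAnnihilatorOfDegree T₁ (n + 1))
    (hsq : ∀ t : T, algebraMap T₁ T'' (algebraMap T T₁ t) = algebraMap T' T'' (algebraMap T T' t))
    (hdesc : (cohomologyAnnihilatorOfDegree T'' (n + 1)).comap (algebraMap T' T'') ≤
      cohomologyAnnihilatorOfDegree T' (n + 1))
    {κ : Type} [Fintype κ] (M : κ → ModuleCat.{u} T₁)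
    (hM : ∀ i, Module.IsReflexive T₁ (M i) ∧
      ∃ X : ModuleCat.{u} T₁, Module.Finite T₁ X ∧ IsSyzygy n X (ModuleCat.of T₁ (Module.Dual T₁ (M i))))
    (hcover : ∀ (N L : ModuleCat.{u} T''), Module.Finite T'' N → IsSyzygy n N L →
      IsRetractOfPower (ModuleCat.of T'' (T'' × (Π i, Module.Dual T'' (Module.Dual T'' (T'' ⊗[T₁] M i))))) L) :
    algebraMap T T' x ∈ cohomologyAnnihilatorOfDegree T' (n + 1) :=
  algebraMap_mem_cohomologyAnnihilatorOfDegree_succ_of_stepGenerator n hx hasc hsq hdesc _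
    (fun _ hy => stablyAnnihilates_hullGenerator n M hM hy) hcover

/-- **The step from a DUAL cover** (o8/o10a's shape) as an instance of the generator form — for comparison with
o10a's `algebraMap_mem_cohomologyAnnihilatorOfDegree_succ_of_stepAddCover` (there via o8 and the unpacked retract
shape; here via the generator). [cite: IyengarTakahashi2014, Remark 2.13] -/
theorem algebraMap_mem_cohomologyAnnihilatorOfDegree_succ_of_stepDualGenerator
    {T T' T₁ T'' : Type u} [CommRing T] [CommRing T'] [CommRing T₁] [CommRing T'']
    [Algebra T T'] [Algebra T T₁] [Algebra T₁ T''] [Algebra T' T''] [IsNoetherianRing T₁] [IsNoetherianRing T'']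
    (n : ℕ) {x : T} (hx : x ∈ cohomologyAnnihilatorOfDegree T (n + 1))
    (hasc : (cohomologyAnnihilatorOfDegree T (n + 1)).map (algebraMap T T₁) ≤
      cohomologyAnnihilatorOfDegree T₁ (n + 1))
    (hsq : ∀ t : T, algebraMap T₁ T'' (algebraMap T T₁ t) = algebraMap T' T'' (algebraMap T T' t))
    (hdesc : (cohomologyAnnihilatorOfDegree T'' (n + 1)).comap (algebraMap T' T'') ≤
      cohomologyAnnihilatorOfDegree T' (n + 1))
    {ι : Type} [Fintype ι] (Y : ι → ModuleCat.{u} T₁)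
    (hY : ∀ j, ∃ X : ModuleCat.{u} T₁, Module.Finite T₁ X ∧ IsSyzygy n X (Y j))
    (hcover : ∀ (N L : ModuleCat.{u} T''), Module.Finite T'' N → IsSyzygy n N L →
      IsRetractOfPower (ModuleCat.of T'' (T'' × (Π j, Module.Dual T'' (T'' ⊗[T₁] Y j)))) L) :
    algebraMap T T' x ∈ cohomologyAnnihilatorOfDegree T' (n + 1) :=
  algebraMap_mem_cohomologyAnnihilatorOfDegree_succ_of_stepGenerator n hx hasc hsq hdesc _
    (fun _ hy => stablyAnnihilates_dualGenerator n Y hY hy) hcover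

/-- **The step from a MIXED cover**: hull blocks of reflexive `M i` (syzygy duals) and dual blocks of syzygies
`Y j` together. [cite: IyengarTakahashi2014, Remark 2.13] -/
theorem algebraMap_mem_cohomologyAnnihilatorOfDegree_succ_of_stepMixedGenerator
    {T T' T₁ T'' : Type u} [CommRing T] [CommRing T'] [CommRing T₁] [CommRing T'']
    [Algebra T T'] [Algebra T T₁] [Algebra T₁ T''] [Algebra T' T''] [IsNoetherianRing T₁] [IsNoetherianRing T'']
    (n : ℕ) {x : T} (hx : x ∈ cohomologyAnnihilatorOfDegree T (n + 1))
    (hasc : (cohomologyAnnihilatorOfDegree T (n + 1)).map (algebraMap T T₁) ≤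
      cohomologyAnnihilatorOfDegree T₁ (n + 1))
    (hsq : ∀ t : T, algebraMap T₁ T'' (algebraMap T T₁ t) = algebraMap T' T'' (algebraMap T T' t))
    (hdesc : (cohomologyAnnihilatorOfDegree T'' (n + 1)).comap (algebraMap T' T'') ≤
      cohomologyAnnihilatorOfDegree T' (n + 1))
    {κ ι : Type} [Fintype κ] [Fintype ι] (M : κ → ModuleCat.{u} T₁)
    (hM : ∀ i, Module.IsReflexive T₁ (M i) ∧
      ∃ X : ModuleCat.{u} T₁, Module.Finite T₁ X ∧ IsSyzygy n X (ModuleCat.of T₁ (Module.Dual T₁ (M i))))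
    (Y : ι → ModuleCat.{u} T₁) (hY : ∀ j, ∃ X : ModuleCat.{u} T₁, Module.Finite T₁ X ∧ IsSyzygy n X (Y j))
    (hcover : ∀ (N L : ModuleCat.{u} T''), Module.Finite T'' N → IsSyzygy n N L →
      IsRetractOfPower (ModuleCat.of T''
        ((T'' × (Π i, Module.Dual T'' (Module.Dual T'' (T'' ⊗[T₁] M i)))) ×
          (Π j, Module.Dual T'' (T'' ⊗[T₁] Y j)))) L) :
    algebraMap T T' x ∈ cohomologyAnnihilatorOfDegree T' (n + 1) :=
  algebraMap_mem_cohomologyAnnihilatorOfDegree_succ_of_stepGenerator n hx hasc hsq hdesc _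
    (fun _ hy => stablyAnnihilates_mixedGenerator n M hM Y hY hy) hcover

end Summit.ResolutionOfSingularities.ResolutionOfSingularities.Theorems.HomologicalConductor.PersistenceSurfaceStepGenerator

end
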